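import Summits.Ventures.DiscreteObjects.Hadamard.Order167WilliamsonType668
import Summits.Ventures.DiscreteObjects.Hadamard.Order167NormalizerSmall668
import Summits.Ventures.DiscreteObjects.Hadamard.Order167InvertingInvolution668
import Summits.Ventures.DiscreteObjects.Hadamard.Order83Centralizer668
import Summits.Ventures.DiscreteObjects.Hadamard.CentralizingInvolutions83and37
import Summits.Ventures.DiscreteObjects.Hadamard.PrimeCentralizerFaithfulAll668
import Summits.Ventures.DiscreteObjects.Hadamard.Order167IndexTwoIto668

/-!
# H(668): the local structure of the signed automorphism group at the primes 167, 83, 41, 37 in ONE file (kernel summary)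

Framing: lottery ticket; floor = certified bounds/negative ranges.

Cell pub-namedobj (venture DiscreteObjects), target (H), hadamard gen 21.  One quotable theorem collecting the gen-21 kernel
results (with the gen-19/20 inputs they rest on) about a signed automorphism `σ = (π, κ, d, e)` of a HYPOTHETICAL Hadamard matrix of
order `668` with `π^167 = κ^167 = 1`, `(π, κ) ≠ (1,1)` — **`hadamard668_local_structure_167`**:
1. CENTRALISER: every `τ` commuting with `σ` (pair level) has pair order dividing `334`, fixes no row and no column unless its
   pair is trivial (FREE action), and has `τ² ∈ ⟨σ⟩`; among five such `τ` two are congruent modulo `⟨σ⟩` (`|C(σ) : ±⟨σ⟩| ≤ 4`).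
2. INVOLUTIONS in the centraliser are nega (`τ² = −I`), have commuting pairs, anticommute as signed maps when distinct, and
   there are at most three involution pairs (the `2`-part of `C±(σ)` is `C₂`, `C₄` or `Q₈` — paper reading).
3. INDEX 4 ⇒ WILLIAMSON TYPE: two centralising `τ₁, τ₂` with distinct non-trivial involution pairs make `H` equivalent to a
   Hadamard matrix `[θ(g,h) · A_{g+h}(t − s)]` on `(ℤ/2 × ℤ/2) × ℤ/167` — four circulant blocks in the Williamson-type
   arrangement, up to signs.
4. NORMALISER: a normalising `τ` (`π'π = π^μ π'`, `κ'κ = κ^μ κ'`) centralises or inverts (`μ ≡ −1`); its square centralises;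
   its pair order is `1, 2, 4, 167` or `334`; the product of two non-centralising normalisers centralises (`N/C ≤ C₂`).
5. INVERTING INVOLUTIONS preserve all four row/column blocks with exactly `4 + 4` fixed points — and then `H` is a `4 × 4` array
   of SYMMETRIC circulant blocks — or no block at all (fixed-point-free, nega).
and **`hadamard668_local_structure_83`**: for `σ` with `π^83 = κ^83 = 1`, `(π, κ) ≠ (1,1)`: the orbit-preserving centraliser is
`⟨σ⟩` (faithful action on the eight row orbits) and a centralising involution fixes `0`, `4` or `332` rows (as many columns);
order `166`: `g^83` fixes `0`, `4` or `332` rows; and **`hadamard668_local_structure_37_41`**: the orbit-preserving centraliser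
of an element of order `37` or `41` is `⟨σ⟩` (faithful action on the `18` / `16` row orbits), and a centralising involution of
an element of order `37` fixes `0`, `76` or `148` rows; for EVERY prime `p ≥ 13` the orbit-preserving centraliser of an
element of order `p` is `⟨σ⟩` — quote `centralizer_rowOrbits_of_prime_ge13` (`PrimeCentralizerFaithfulAll668`) directly; and
the Williamson array with circulant blocks of order `167`, if Hadamard, realises the index-4 configuration — quote
`williamsonArray_index_four_realized` (`WilliamsonArrayQuaternion668`); **`hadamard668_order167_index_two_ito`**:
a centralising non-trivial involution pair (index ≥ 2) makes `τσ` an element of pair order `334` and `H` a `2 × 2` negacyclic array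
(the Ito line, gen 19's dictionary) — so the three values `1, 2, 4` of the index are the sixteen-circulant, Ito and Williamson shapes;
the centraliser of `σ₁₆₇` is ABELIAN at the pair level — quote `hadamard668_order167_centralizer_abelian`
(`Order167CentralizerAbelian668`) directly; the Williamson-type IFF is `hadamard668_index_four_iff_williamsonType`
(`Order167WilliamsonIff668`).
Nothing new is proved here; STRUCTURE / DICTIONARY of a hypothetical object; no automorphism order and no Hadamard order is
excluded; H(668) untouched; HITS 0/4.  Ours; no `sorry`.
-/

namespace Summit.Ventures.DiscreteObjects.Hadamard

open Finset BigOperators Matrix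

open Literature.Combinatorics.Designs.GoethalsSeidel (IsHadamardMatrix)

variable {ι : Type*} [Fintype ι] [DecidableEq ι]

variable {H : Matrix ι ι ℤ}

/-- **The 167-local structure of Aut± H(668), kernel summary** (see the module docstring for the numbered items). -/
theorem hadamard668_local_structure_167 (hH : IsHadamardMatrix H) (hι : Fintype.card ι = 668)
    {π κ : Equiv.Perm ι} {d e : ι → ℤ} (haut : IsSignedAut H π κ d e)
    (hπ : π ^ 167 = 1) (hκ : κ ^ 167 = 1) (hne : π ≠ 1 ∨ κ ≠ 1) :
    -- 1. centraliser: pair order ∣ 334, free action, square in ⟨σ⟩, index ≤ 4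
    (∀ {π' κ' : Equiv.Perm ι} {d' e' : ι → ℤ}, IsSignedAut H π' κ' d' e' → Commute π' π → Commute κ' κ →
      orderOf ((π', κ') : Equiv.Perm ι × Equiv.Perm ι) ∣ 334 ∧
      ((π' ≠ 1 ∨ κ' ≠ 1) → (∀ x, π' x ≠ x) ∧ (∀ y, κ' y ≠ y)) ∧
      (∃ c : ℕ, π' ^ 2 = π ^ c ∧ κ' ^ 2 = κ ^ c)) ∧
    (∀ (πs κs : Fin 5 → Equiv.Perm ι) (ds es : Fin 5 → ι → ℤ),
      (∀ i, IsSignedAut H (πs i) (κs i) (ds i) (es i)) → (∀ i, Commute (πs i) π) → (∀ i, Commute (κs i) κ) →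
      ∃ i j : Fin 5, i ≠ j ∧ ∃ c : ℕ, πs j = πs i * π ^ c ∧ κs j = κs i * κ ^ c) ∧
    -- 2. centralising involutions: nega, commuting pairs, anticommuting signs, at most three
    (∀ {π' κ' : Equiv.Perm ι} {d' e' : ι → ℤ}, IsSignedAut H π' κ' d' e' → Commute π' π → π' ^ 2 = 1 → κ' ^ 2 = 1 →
      (π' ≠ 1 ∨ κ' ≠ 1) → (∀ i, d' (π' i) * d' i = -1) ∧ (∀ j, e' (κ' j) * e' j = -1)) ∧
    (∀ {π₁ κ₁ π₂ κ₂ : Equiv.Perm ι} {d₁ e₁ d₂ e₂ : ι → ℤ}, IsSignedAut H π₁ κ₁ d₁ e₁ → IsSignedAut H π₂ κ₂ d₂ e₂ →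
      Commute π₁ π → Commute κ₁ κ → Commute π₂ π → Commute κ₂ κ → π₁ ^ 2 = 1 → κ₁ ^ 2 = 1 → π₂ ^ 2 = 1 → κ₂ ^ 2 = 1 →
      (Commute π₁ π₂ ∧ Commute κ₁ κ₂) ∧
      ((π₁ ≠ 1 ∨ κ₁ ≠ 1) → (π₂ ≠ 1 ∨ κ₂ ≠ 1) → (π₁ ≠ π₂ ∨ κ₁ ≠ κ₂) →
        ∀ i, d₁ (π₂ i) * d₂ i = -(d₂ (π₁ i) * d₁ i))) ∧
    (∀ (πs κs : Fin 4 → Equiv.Perm ι) (ds es : Fin 4 → ι → ℤ),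
      (∀ i, IsSignedAut H (πs i) (κs i) (ds i) (es i)) → (∀ i, Commute (πs i) π) → (∀ i, Commute (κs i) κ) →
      (∀ i, πs i ^ 2 = 1 ∧ κs i ^ 2 = 1) → (∀ i, πs i ≠ 1 ∨ κs i ≠ 1) →
      ∃ i j : Fin 4, i ≠ j ∧ πs i = πs j ∧ κs i = κs j) ∧
    -- 3. index 4 ⇒ Williamson-type array
    (∀ {π₁ κ₁ π₂ κ₂ : Equiv.Perm ι} {d₁ e₁ d₂ e₂ : ι → ℤ}, IsSignedAut H π₁ κ₁ d₁ e₁ → IsSignedAut H π₂ κ₂ d₂ e₂ →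
      Commute π₁ π → Commute κ₁ κ → Commute π₂ π → Commute κ₂ κ → π₁ ^ 2 = 1 → κ₁ ^ 2 = 1 → π₂ ^ 2 = 1 → κ₂ ^ 2 = 1 →
      (π₁ ≠ 1 ∨ κ₁ ≠ 1) → (π₂ ≠ 1 ∨ κ₂ ≠ 1) → (π₁ ≠ π₂ ∨ κ₁ ≠ κ₂) →
      ∃ (θ : ZMod 2 × ZMod 2 → ZMod 2 × ZMod 2 → ℤ) (A : ZMod 2 × ZMod 2 → ZMod 167 → ℤ),
        (∀ g h, θ g h = 1 ∨ θ g h = -1) ∧ (∀ k r, A k r = 1 ∨ A k r = -1) ∧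
        IsHadamardMatrix (Matrix.of fun (a b : (ZMod 2 × ZMod 2) × ZMod 167) =>
          θ a.1 b.1 * A (a.1 + b.1) (b.2 - a.2)) ∧
        Fintype.card ((ZMod 2 × ZMod 2) × ZMod 167) = 668) ∧
    -- 4. normaliser: dichotomy, square centralises, pair orders, N/C ≤ C₂
    (∀ {π' κ' : Equiv.Perm ι} {d' e' : ι → ℤ} {μ : ℕ}, IsSignedAut H π' κ' d' e' → π' * π = π ^ μ * π' →
      κ' * κ = κ ^ μ * κ' →
      ((Commute π' π ∧ Commute κ' κ) ∨ (μ : ZMod 167) = -1) ∧ (Commute (π' ^ 2) π ∧ Commute (κ' ^ 2) κ) ∧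
      orderOf ((π', κ') : Equiv.Perm ι × Equiv.Perm ι) ∈ ({1, 2, 4, 167, 334} : Finset ℕ)) ∧
    (∀ {π₁ κ₁ π₂ κ₂ : Equiv.Perm ι} {d₁ e₁ d₂ e₂ : ι → ℤ} {μ₁ μ₂ : ℕ}, IsSignedAut H π₁ κ₁ d₁ e₁ →
      IsSignedAut H π₂ κ₂ d₂ e₂ → π₁ * π = π ^ μ₁ * π₁ → κ₁ * κ = κ ^ μ₁ * κ₁ → π₂ * π = π ^ μ₂ * π₂ →
      κ₂ * κ = κ ^ μ₂ * κ₂ → ¬ (Commute π₁ π ∧ Commute κ₁ κ) → ¬ (Commute π₂ π ∧ Commute κ₂ κ) →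
      Commute (π₁ * π₂) π ∧ Commute (κ₁ * κ₂) κ) ∧
    -- 5. inverting involutions: all blocks (4 + 4 fixed, symmetric array) or none
    (∀ {π' κ' : Equiv.Perm ι} {d' e' : ι → ℤ} {μ : ℕ}, IsSignedAut H π' κ' d' e' → π' * π = π ^ μ * π' →
      κ' * κ = κ ^ μ * κ' → μ % 167 = 166 → π' ^ 2 = 1 → κ' ^ 2 = 1 → (π' ≠ 1 ∨ κ' ≠ 1) →
      (((∀ x, π' x ∈ orbFin π 167 x) ∧ (∀ y, κ' y ∈ orbFin κ 167 y) ∧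
          (univ.filter fun x => π' x = x).card = 4 ∧ (univ.filter fun y => κ' y = y).card = 4) ∨
        ((∀ x, π' x ∉ orbFin π 167 x) ∧ (∀ y, κ' y ∉ orbFin κ 167 y) ∧
          (univ.filter fun x => π' x = x).card = 0 ∧ (univ.filter fun y => κ' y = y).card = 0)) ∧
      ((∃ x, π' x = x) → ∃ x : Fin 4 → Fin 4 → ZMod 167 → ℤ,
        IsHadamardMatrix (Matrix.of fun (a b : Fin 4 × ZMod 167) => x a.1 b.1 (b.2 - a.2)) ∧
        Fintype.card (Fin 4 × ZMod 167) = 668 ∧ ∀ p q r, x p q (-r) = x p q r)) := by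
  refine ⟨?_, ?_, ?_, ?_, ?_, ?_, ?_, ?_, ?_⟩
  · intro π' κ' d' e' haut' hcπ hcκ
    exact ⟨centralizer167_orderOf_dvd hH hι haut hπ hκ hne haut' hcπ hcκ,
      fun hne' => hadamard668_order167_centralizer_free hH hι haut hπ hκ hne haut' hcπ hcκ hne',
      hadamard668_order167_centralizer_sq_mem hH hι haut hπ hκ hne haut' hcπ hcκ⟩
  · intro πs κs ds es hs hcs hcs'
    exact hadamard668_order167_centralizer_index_le_four hH hι haut hπ hκ hne πs κs ds es hs hcs hcs'
  · intro π' κ' d' e' haut' hcπ h2 h2' hne'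
    exact centralizer167_involution_sq_signs hH hι haut hπ hκ hne haut' hcπ h2 h2' hne'
  · intro π₁ κ₁ π₂ κ₂ d₁ e₁ d₂ e₂ h₁ h₂ hc₁ hc₁' hc₂ hc₂' hi₁ hi₁' hi₂ hi₂'
    refine ⟨(centralizer167_involutions_commute hH hι haut hπ hκ hne h₁ h₂ hc₁ hc₁' hc₂ hc₂' hi₁ hi₁' hi₂ hi₂').1,
      fun hne₁ hne₂ hne₁₂ => ?_⟩
    exact (centralizer167_involutions_anticommute hH hι haut hπ hκ hne h₁ h₂ hc₁ hc₁' hc₂ hc₂' hi₁ hi₁' hi₂ hi₂'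
      hne₁ hne₂ hne₁₂).1
  · intro πs κs ds es hs hcs hcs' hinv hnt
    exact centralizer167_involutions_le_three hH hι haut hπ hκ hne πs κs ds es hs hcs hcs' hinv hnt
  · intro π₁ κ₁ π₂ κ₂ d₁ e₁ d₂ e₂ h₁ h₂ hc₁ hc₁' hc₂ hc₂' hi₁ hi₁' hi₂ hi₂' hne₁ hne₂ hne₁₂
    exact exists_williamsonTypeArray_of_centralizer_index_four hH hι haut hπ hκ hne h₁ h₂ hc₁ hc₁' hc₂ hc₂' hi₁ hi₁'
      hi₂ hi₂' hne₁ hne₂ hne₁₂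
  · intro π' κ' d' e' μ haut' hnπ hnκ
    exact ⟨hadamard668_order167_normalizer_dichotomy hH hι haut hπ hκ hne haut' hnπ hnκ,
      hadamard668_order167_normalizer_sq_centralizes hH hι haut hπ hκ hne haut' hnπ hnκ,
      hadamard668_order167_normalizer_orderOf_mem hH hι haut hπ hκ hne haut' hnπ hnκ⟩
  · intro π₁ κ₁ π₂ κ₂ d₁ e₁ d₂ e₂ μ₁ μ₂ h₁ h₂ hn₁ hn₁' hn₂ hn₂' hnc₁ hnc₂
    exact hadamard668_order167_normalizer_mul_centralizes hH hι haut hπ hκ hne h₁ h₂ hn₁ hn₁' hn₂ hn₂' hnc₁ hnc₂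
  · intro π' κ' d' e' μ haut' hnπ hnκ hμ h2 h2' hne'
    refine ⟨?_, fun hfix => hadamard668_order167_inverting_involution_symmetricArray hH hι haut hπ hκ hne haut' hnπ hnκ
      hμ h2 h2' hne' hfix⟩
    rcases hadamard668_order167_inverting_involution hH hι haut hπ hκ hne haut' hnπ hnκ hμ h2 h2' hne' with
      ⟨h1, h2r, h3, h4⟩ | ⟨h1, h2r, h3, h4, -, -⟩
    · exact Or.inl ⟨h1, h2r, h3, h4⟩
    · exact Or.inr ⟨h1, h2r, h3, h4⟩

/-- **The 83-local structure, kernel summary**: faithful action of the centraliser on the eight orbits; centralising involutions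
fix `0`, `4` or `332` rows; order `166` window. -/
theorem hadamard668_local_structure_83 (hH : IsHadamardMatrix H) (hι : Fintype.card ι = 668)
    {π κ : Equiv.Perm ι} {d e : ι → ℤ} (haut : IsSignedAut H π κ d e)
    (hπ : π ^ 83 = 1) (hκ : κ ^ 83 = 1) (hne : π ≠ 1 ∨ κ ≠ 1) :
    (∀ {π' κ' : Equiv.Perm ι} {d' e' : ι → ℤ}, IsSignedAut H π' κ' d' e' → Commute π' π → Commute κ' κ →
      (∀ x, π x ≠ x → ∃ c : ℕ, π' x = (π ^ c) x) → ∃ c : ℕ, π' = π ^ c ∧ κ' = κ ^ c) ∧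
    (∀ {π' κ' : Equiv.Perm ι} {d' e' : ι → ℤ}, IsSignedAut H π' κ' d' e' → Commute π' π → π' ^ 2 = 1 → κ' ^ 2 = 1 →
      (π' ≠ 1 ∨ κ' ≠ 1) →
      (univ.filter fun x => π' x = x).card = (univ.filter fun y => κ' y = y).card ∧
      ((univ.filter fun x => π' x = x).card = 0 ∨ (univ.filter fun x => π' x = x).card = 4 ∨
        (univ.filter fun x => π' x = x).card = 332)) ∧
    (∀ (π' κ' : Equiv.Perm ι) (d' e' : ι → ℤ), IsSignedAut H π' κ' d' e' →
      orderOf ((π', κ') : Equiv.Perm ι × Equiv.Perm ι) = 166 →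
      (univ.filter fun x => (π' ^ 83) x = x).card = 0 ∨ (univ.filter fun x => (π' ^ 83) x = x).card = 4 ∨
        (univ.filter fun x => (π' ^ 83) x = x).card = 332) := by
  refine ⟨?_, ?_, ?_⟩
  · intro π' κ' d' e' haut' hcπ hcκ hpres
    exact hadamard668_order83_centralizer_rowOrbits hH hι haut hπ hκ hne haut' hcπ hcκ hpres
  · intro π' κ' d' e' haut' hcπ h2 h2' hne'
    exact hadamard668_order83_centralizing_involution hH hι haut haut' hcπ h2 h2' hne' hπ hκ hne
  · intro π' κ' d' e' haut' hord
    exact hadamard668_orderOf_166_pow83_fixed hH hι haut' hord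

/-- **The 37- and 41-local structure, kernel summary**: faithful action of the centraliser on the row orbits; centralising
involutions of an element of order `37` fix `0`, `76` or `148` rows. -/
theorem hadamard668_local_structure_37_41 (hH : IsHadamardMatrix H) (hι : Fintype.card ι = 668)
    {π κ : Equiv.Perm ι} {d e : ι → ℤ} (haut : IsSignedAut H π κ d e) :
    (π ^ 37 = 1 → κ ^ 37 = 1 → (π ≠ 1 ∨ κ ≠ 1) →
      (∀ {π' κ' : Equiv.Perm ι} {d' e' : ι → ℤ}, IsSignedAut H π' κ' d' e' → Commute π' π → Commute κ' κ →
        (∀ x, π x ≠ x → ∃ c : ℕ, π' x = (π ^ c) x) → ∃ c : ℕ, π' = π ^ c ∧ κ' = κ ^ c) ∧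
      (∀ {π' κ' : Equiv.Perm ι} {d' e' : ι → ℤ}, IsSignedAut H π' κ' d' e' → Commute π' π → π' ^ 2 = 1 → κ' ^ 2 = 1 →
        (π' ≠ 1 ∨ κ' ≠ 1) →
        (univ.filter fun x => π' x = x).card = (univ.filter fun y => κ' y = y).card ∧
        ((univ.filter fun x => π' x = x).card = 0 ∨ (univ.filter fun x => π' x = x).card = 76 ∨
          (univ.filter fun x => π' x = x).card = 148))) ∧
    (π ^ 41 = 1 → κ ^ 41 = 1 → (π ≠ 1 ∨ κ ≠ 1) →
      ∀ {π' κ' : Equiv.Perm ι} {d' e' : ι → ℤ}, IsSignedAut H π' κ' d' e' → Commute π' π → Commute κ' κ →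
        (∀ x, π x ≠ x → ∃ c : ℕ, π' x = (π ^ c) x) → ∃ c : ℕ, π' = π ^ c ∧ κ' = κ ^ c) := by
  refine ⟨fun hπ hκ hne => ⟨?_, ?_⟩, fun hπ hκ hne => ?_⟩
  · intro π' κ' d' e' haut' hcπ hcκ hpres
    exact hadamard668_order37_centralizer_rowOrbits hH hι haut haut' hcπ hcκ hpres hπ hκ hne
  · intro π' κ' d' e' haut' hcπ h2 h2' hne'
    exact hadamard668_order37_centralizing_involution hH hι haut haut' hcπ h2 h2' hne' hπ hκ hne
  · intro π' κ' d' e' haut' hcπ hcκ hpres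
    exact hadamard668_order41_centralizer_rowOrbits hH hι haut haut' hcπ hcκ hpres hπ hκ hne

/-- **Index ≥ 2 ⇒ Ito line, kernel summary**: a centralising signed automorphism with non-trivial involution pair gives an
element of pair order `334` and a Hadamard `2 × 2` array of negacyclic blocks of order `334` equivalent to `H`. -/
theorem hadamard668_order167_index_two_ito (hH : IsHadamardMatrix H) (hι : Fintype.card ι = 668)
    {π κ : Equiv.Perm ι} {d e : ι → ℤ} (haut : IsSignedAut H π κ d e)
    (hπ : π ^ 167 = 1) (hκ : κ ^ 167 = 1) (hne : π ≠ 1 ∨ κ ≠ 1)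
    {π' κ' : Equiv.Perm ι} {d' e' : ι → ℤ} (haut' : IsSignedAut H π' κ' d' e') (hcπ : Commute π' π) (hcκ : Commute κ' κ)
    (h2 : π' ^ 2 = 1) (h2' : κ' ^ 2 = 1) (hne' : π' ≠ 1 ∨ κ' ≠ 1) :
    orderOf ((π' * π, κ' * κ) : Equiv.Perm ι × Equiv.Perm ι) = 334 ∧
    ∃ x : Fin 2 → Fin 2 → ZMod 668 → ℤ, (∀ p q r, x p q (r + 334) = -x p q r) ∧
      IsHadamardMatrix (Matrix.of fun (a b : Fin 2 × ZMod 334) => x a.1 b.1 ((b.2.val : ZMod 668) - (a.2.val : ZMod 668))) ∧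
      Fintype.card (Fin 2 × ZMod 334) = 668 :=
  ⟨centralizer167_involution_mul_orderOf hπ hκ hne hcπ hcκ h2 h2' hne',
    exists_negacyclicArray_of_centralizer167_involution hH hι haut hπ hκ hne haut' hcπ hcκ h2 h2' hne'⟩

end Summit.Ventures.DiscreteObjects.Hadamard
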